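import Summits.BirchSwinnertonDyer.BirchSwinnertonDyer.Theorems.AdditiveKolyvaginRoadRamifiedHabitatSignLawEven
import HarnessLib

/-!
# Route `AdditiveKolyvaginRoad`, crux KS′ `LevelKolyvaginSystemsAdditive` (stmt-BirchSwinnertonDyer-21396), card `ramified-toric-habitat` —
# the ramified-habitat sign law for an EVEN habitat discriminant: STARRED types IV*/III*/II* and type I₀*

Cell `pub/bsd-wall`, width seat `bsd-wall-akr-p2x-w3` g13; `--supports stmt-BirchSwinnertonDyer-21396` (helper). THEOREMS ONLY; no definition,
no named fact, no `sorry`. BSD is not proved by any of this; KS′/KPA′ stay OPEN at `p² ∣ N`.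

Continuation of `…RamifiedHabitatSignLawEven` (§1–§3: the structural law `w(E^{(d)}) = −(−1/p)·(D'/N_{E'})·w(E')` for `d = p*·D'`, `D' = 4m` an even
fundamental discriminant, and types II/III/IV at any level). Here, for `E` semistable away from `p` (`N = M p²`, `M` squarefree), the remaining
potentially good rows, fed by the `p*`-level theorems of w2 g11's parts 5–7:

* §4 `rootNumber_mul_rootNumber_ramifiedTwist_even_of_ge` — types IV*, III*, II* (`ord_p Δ_min = a ∈ {8, 9, 10}`, `e = 3, 4, 6`):
  `w(E)·w(E^{(d)}) = −(−1/p)` (`e = 4`), `−(−3/p)` (`e ∈ {3, 6}`), via `rootNumber_mul_rootNumber_pStarTwist_of_localData` and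
  `localRootNumber_mul_pStarTwist_padic_of_ge`; dichotomy halves `…_eq_one_of_not_dvd` / `…_eq_neg_one_of_dvd`.
* §5 `rootNumber_mul_rootNumber_ramifiedTwist_even_of_six` — type I₀* (`a = 6`, `e = 2 ∣ p − 1`): `w(E)·w(E^{(d)}) = −1`, modulo the Modularity
  Theorem ONLY (`E^{(p*)}` is good at `p`, `N_{E'} = M`, the `k = 0` case of §2).

Conditional on `exists_isNewformOf` and (§4) Kellock–Dokchitser's Rem. 2.2 at `p` for `E`, `E^{(p*)}`.

References: [cite: MurtyMurty1997, Ch. 6 §1] [cite: Rohrlich1993Compositio, Prop. 2(iv)] [cite: KellockDokchitser2023, Rem. 2.2].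
-/

set_option autoImplicit false
set_option linter.dupNamespace false

noncomputable section

open scoped Classical MatrixGroups NumberTheorySymbols

open CongruenceSubgroup IsDedekindDomain IsDedekindDomain.HeightOneSpectrum NumberField Rat.HeightOneSpectrum
  WeierstrassCurve Literature.NumberTheory.EllipticCurves Literature.NumberTheory.EllipticCurves.ModularForms
  IsDiscreteValuationRing

namespace Summit.BirchSwinnertonDyer.BirchSwinnertonDyer.Theorems.AdditiveKoly.RamifiedHabitat

/-! ## §4 Starred types IV*/III*/II*, even habitat discriminant -/

section EvenStarred

variable {p : ℕ} [Fact p.Prime]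

/-- **THE SIGN RATIO, EVEN HABITAT DISCRIMINANT, STARRED TYPES IV*/III*/II*** (`ord_p Δ_min = a ∈ {8,9,10}`, `e = 3, 4, 6`), `E` semistable away from
`p` (`M` squarefree): `w(W)·w(W^{(d)}) = −(−1/p)` (`e = 4`), `= −(−3/p)` (`e ∈ {3,6}`). Conditional on {hmod, F1 at `p`}.
[cite: Rohrlich1993Compositio, Prop. 2(iv)] [cite: KellockDokchitser2023, Rem. 2.2] -/
theorem rootNumber_mul_rootNumber_ramifiedTwist_even_of_ge (W : WeierstrassCurve ℚ) [W.IsElliptic] (hmod : exists_isNewformOf)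
    (hF1 : W.atkinLehnerEigenvalueAt_eq_localRootNumberAt)
    (hF1' : (W.quadraticTwist (((-1 : ℤ) ^ (p / 2) * p : ℤ) : ℚ)).atkinLehnerEigenvalueAt_eq_localRootNumberAt)
    (hp5 : 5 ≤ p) {M : ℕ} (hN : W.conductorNorm ℤ = M * p ^ 2) (hM : Squarefree M) (hpM : ¬ p ∣ M) {a : ℕ}
    (hΔ : addVal ℤ_[p] (((W.baseChange ℚ_[p]).minimal ℤ_[p]).integralModel ℤ_[p]).Δ = a)
    (ha : a = 8 ∨ a = 9 ∨ a = 10)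
    (hc₄ : addVal ℤ_[p] (((W.baseChange ℚ_[p]).minimal ℤ_[p]).integralModel ℤ_[p]).c₄ ≠ 0)
    (hj : ¬ 3 * addVal ℤ_[p] (((W.baseChange ℚ_[p]).minimal ℤ_[p]).integralModel ℤ_[p]).c₄ <
      addVal ℤ_[p] (((W.baseChange ℚ_[p]).minimal ℤ_[p]).integralModel ℤ_[p]).Δ)
    {D' : ℤ} (h4 : 4 ∣ D') (hm4 : D' / 4 % 4 = 2 ∨ D' / 4 % 4 = 3) (hsq : Squarefree (D' / 4))
    (hgcd : Int.gcd D' (W.conductorNorm ℤ) = 1) (hneg : (-1 : ℤ) ^ (p / 2) * p * D' < 0)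
    (hsplit : ∀ q ∈ M.primeFactors, q ≠ 2 → J((-1 : ℤ) ^ (p / 2) * p * D' | q) = 1) :
    W.rootNumber * (W.quadraticTwist (((-1 : ℤ) ^ (p / 2) * p * D' : ℤ) : ℚ)).rootNumber =
      if a = 9 then -ZMod.χ₄ p else -(if p % 3 = 1 then 1 else -1) := by
  have hp : p.Prime := Fact.out
  have hp2 : p ≠ 2 := by omega
  have hdZ0 : ((-1 : ℤ) ^ (p / 2) * p : ℤ) ≠ 0 :=
    mul_ne_zero (pow_ne_zero _ (by norm_num)) (by exact_mod_cast hp.ne_zero)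
  have hd0 : (((((-1 : ℤ) ^ (p / 2) * p : ℤ)) : ℚ)) ≠ 0 := by exact_mod_cast hdZ0
  haveI hE' : (W.quadraticTwist (((-1 : ℤ) ^ (p / 2) * p : ℤ) : ℚ)).IsElliptic := W.isElliptic_quadraticTwist hd0
  obtain ⟨hadd, hadd', hprod⟩ := localRootNumber_mul_pStarTwist_padic_of_ge W hp5 hΔ ha hc₄ hj
  have hA := rootNumber_mul_rootNumber_pStarTwist_of_localData W hmod hF1 hF1' hp5 hN hM hpM hadd hadd' hprod
  have hN' : (W.quadraticTwist (((-1 : ℤ) ^ (p / 2) * p : ℤ) : ℚ)).conductorNorm ℤ = M * p ^ 2 :=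
    (conductorNorm_pStarTwist_eq W hp5 hadd hadd').trans hN
  have hgcd' : Int.gcd D' (M * p ^ 2 : ℕ) = 1 := by rw [← hN]; exact hgcd
  rw [rootNumber_mul_rootNumber_ramifiedTwist_of_four_dvd_of_pStar W hmod hp2 hpM hN' hA h4 hm4 hsq hgcd' hneg hsplit,
    jacobiSym_cofactor_prime_sq_eq_one hgcd']
  have hχ₄ := χ₄_natCast_mul_self hp2
  split_ifs
  · ring
  · linear_combination -hχ₄
  · linear_combination hχ₄

/-- **SUPERCUSPIDAL HALF, even habitat discriminant, STARRED TYPES** (`e ∤ p − 1 ⟹ +1`; `e := 12/gcd(12,a)`, `a ∈ {8,9,10}`).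
Conditional on {hmod, F1 at `p`}. [cite: Rohrlich1993Compositio, Prop. 2(iv)] [cite: KellockDokchitser2023, Rem. 2.2] -/
theorem rootNumber_mul_rootNumber_ramifiedTwist_even_of_ge_eq_one_of_not_dvd (W : WeierstrassCurve ℚ) [W.IsElliptic]
    (hmod : exists_isNewformOf) (hF1 : W.atkinLehnerEigenvalueAt_eq_localRootNumberAt)
    (hF1' : (W.quadraticTwist (((-1 : ℤ) ^ (p / 2) * p : ℤ) : ℚ)).atkinLehnerEigenvalueAt_eq_localRootNumberAt)
    (hp5 : 5 ≤ p) {M : ℕ} (hN : W.conductorNorm ℤ = M * p ^ 2) (hM : Squarefree M) (hpM : ¬ p ∣ M) {a : ℕ}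
    (hΔ : addVal ℤ_[p] (((W.baseChange ℚ_[p]).minimal ℤ_[p]).integralModel ℤ_[p]).Δ = a)
    (ha : a = 8 ∨ a = 9 ∨ a = 10)
    (hc₄ : addVal ℤ_[p] (((W.baseChange ℚ_[p]).minimal ℤ_[p]).integralModel ℤ_[p]).c₄ ≠ 0)
    (hj : ¬ 3 * addVal ℤ_[p] (((W.baseChange ℚ_[p]).minimal ℤ_[p]).integralModel ℤ_[p]).c₄ <
      addVal ℤ_[p] (((W.baseChange ℚ_[p]).minimal ℤ_[p]).integralModel ℤ_[p]).Δ)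
    {D' : ℤ} (h4 : 4 ∣ D') (hm4 : D' / 4 % 4 = 2 ∨ D' / 4 % 4 = 3) (hsq : Squarefree (D' / 4))
    (hgcd : Int.gcd D' (W.conductorNorm ℤ) = 1) (hneg : (-1 : ℤ) ^ (p / 2) * p * D' < 0)
    (hsplit : ∀ q ∈ M.primeFactors, q ≠ 2 → J((-1 : ℤ) ^ (p / 2) * p * D' | q) = 1)
    (hsc : ¬ 12 / Nat.gcd a 12 ∣ p - 1) :
    W.rootNumber * (W.quadraticTwist (((-1 : ℤ) ^ (p / 2) * p * D' : ℤ) : ℚ)).rootNumber = 1 := by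
  rw [rootNumber_mul_rootNumber_ramifiedTwist_even_of_ge W hmod hF1 hF1' hp5 hN hM hpM hΔ ha hc₄ hj h4 hm4 hsq hgcd hneg hsplit]
  have hp' := (Nat.Prime.eq_two_or_odd (Fact.out : p.Prime)).resolve_left (by omega)
  rcases ha with rfl | rfl | rfl
  · have e3 : 12 / Nat.gcd 8 12 = 3 := by decide
    rw [e3] at hsc
    have h3 : p % 3 ≠ 1 := fun h ↦ hsc (by omega)
    simp [h3]
  · have e4 : 12 / Nat.gcd 9 12 = 4 := by decide
    rw [e4] at hsc
    have h4' : p % 4 = 3 := by omega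
    simp [ZMod.χ₄_nat_three_mod_four h4']
  · have e6 : 12 / Nat.gcd 10 12 = 6 := by decide
    rw [e6] at hsc
    have h3 : p % 3 ≠ 1 := fun h ↦ hsc (by omega)
    simp [h3]

/-- **PRINCIPAL-SERIES HALF, even habitat discriminant, STARRED TYPES** (`e ∣ p − 1 ⟹ −1`). Conditional on {hmod, F1 at `p`}.
[cite: Rohrlich1993Compositio, Prop. 2(iv)] [cite: KellockDokchitser2023, Rem. 2.2] -/
theorem rootNumber_mul_rootNumber_ramifiedTwist_even_of_ge_eq_neg_one_of_dvd (W : WeierstrassCurve ℚ) [W.IsElliptic]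
    (hmod : exists_isNewformOf) (hF1 : W.atkinLehnerEigenvalueAt_eq_localRootNumberAt)
    (hF1' : (W.quadraticTwist (((-1 : ℤ) ^ (p / 2) * p : ℤ) : ℚ)).atkinLehnerEigenvalueAt_eq_localRootNumberAt)
    (hp5 : 5 ≤ p) {M : ℕ} (hN : W.conductorNorm ℤ = M * p ^ 2) (hM : Squarefree M) (hpM : ¬ p ∣ M) {a : ℕ}
    (hΔ : addVal ℤ_[p] (((W.baseChange ℚ_[p]).minimal ℤ_[p]).integralModel ℤ_[p]).Δ = a)
    (ha : a = 8 ∨ a = 9 ∨ a = 10)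
    (hc₄ : addVal ℤ_[p] (((W.baseChange ℚ_[p]).minimal ℤ_[p]).integralModel ℤ_[p]).c₄ ≠ 0)
    (hj : ¬ 3 * addVal ℤ_[p] (((W.baseChange ℚ_[p]).minimal ℤ_[p]).integralModel ℤ_[p]).c₄ <
      addVal ℤ_[p] (((W.baseChange ℚ_[p]).minimal ℤ_[p]).integralModel ℤ_[p]).Δ)
    {D' : ℤ} (h4 : 4 ∣ D') (hm4 : D' / 4 % 4 = 2 ∨ D' / 4 % 4 = 3) (hsq : Squarefree (D' / 4))
    (hgcd : Int.gcd D' (W.conductorNorm ℤ) = 1) (hneg : (-1 : ℤ) ^ (p / 2) * p * D' < 0)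
    (hsplit : ∀ q ∈ M.primeFactors, q ≠ 2 → J((-1 : ℤ) ^ (p / 2) * p * D' | q) = 1)
    (hps : 12 / Nat.gcd a 12 ∣ p - 1) :
    W.rootNumber * (W.quadraticTwist (((-1 : ℤ) ^ (p / 2) * p * D' : ℤ) : ℚ)).rootNumber = -1 := by
  rw [rootNumber_mul_rootNumber_ramifiedTwist_even_of_ge W hmod hF1 hF1' hp5 hN hM hpM hΔ ha hc₄ hj h4 hm4 hsq hgcd hneg hsplit]
  have hp' := (Nat.Prime.eq_two_or_odd (Fact.out : p.Prime)).resolve_left (by omega)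
  rcases ha with rfl | rfl | rfl
  · have e3 : 12 / Nat.gcd 8 12 = 3 := by decide
    rw [e3] at hps
    have h3 : p % 3 = 1 := by omega
    simp [h3]
  · have e4 : 12 / Nat.gcd 9 12 = 4 := by decide
    rw [e4] at hps
    have h4' : p % 4 = 1 := by omega
    simp [ZMod.χ₄_nat_one_mod_four h4']
  · have e6 : 12 / Nat.gcd 10 12 = 6 := by decide
    rw [e6] at hps
    have h3 : p % 3 = 1 := by omega
    simp [h3]

/-! ## §5 Type I₀*, even habitat discriminant -/

/-- **TYPE I₀* IN THE EVEN RAMIFIED HABITAT: `w(E)·w(E^{(d)}) = −1`, unconditional modulo Modularity.** `E` of conductor `N = M p²` (`M` squarefree,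
`p ≥ 5`, `p ∤ M`), `ord_p Δ_min = 6` (type I₀*, `e = 2 ∣ p − 1`); `d = p*·D'` with `D'` an even fundamental discriminant prime to `N`, `d < 0`, every
prime of `M` split in `ℚ(√d)`. Here `E^{(p*)}` is GOOD at `p` (`N_{E'} = M`, `k = 0` in §2) and Kellock–Dokchitser at `p` is a tree theorem
(`rootNumber_mul_rootNumber_pStarTwist_of_six`). [cite: MurtyMurty1997, Ch. 6 §1] [cite: Rohrlich1993Compositio, Prop. 2(iv)] -/
theorem rootNumber_mul_rootNumber_ramifiedTwist_even_of_six (W : WeierstrassCurve ℚ) [W.IsElliptic] (hmod : exists_isNewformOf)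
    (hp5 : 5 ≤ p) {M : ℕ} (hN : W.conductorNorm ℤ = M * p ^ 2) (hM : Squarefree M) (hpM : ¬ p ∣ M)
    (hΔ : addVal ℤ_[p] (((W.baseChange ℚ_[p]).minimal ℤ_[p]).integralModel ℤ_[p]).Δ = (6 : ℕ))
    (hc₄ : addVal ℤ_[p] (((W.baseChange ℚ_[p]).minimal ℤ_[p]).integralModel ℤ_[p]).c₄ ≠ 0)
    (hj : ¬ 3 * addVal ℤ_[p] (((W.baseChange ℚ_[p]).minimal ℤ_[p]).integralModel ℤ_[p]).c₄ <
      addVal ℤ_[p] (((W.baseChange ℚ_[p]).minimal ℤ_[p]).integralModel ℤ_[p]).Δ)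
    {D' : ℤ} (h4 : 4 ∣ D') (hm4 : D' / 4 % 4 = 2 ∨ D' / 4 % 4 = 3) (hsq : Squarefree (D' / 4))
    (hgcd : Int.gcd D' (W.conductorNorm ℤ) = 1) (hneg : (-1 : ℤ) ^ (p / 2) * p * D' < 0)
    (hsplit : ∀ q ∈ M.primeFactors, q ≠ 2 → J((-1 : ℤ) ^ (p / 2) * p * D' | q) = 1) :
    W.rootNumber * (W.quadraticTwist (((-1 : ℤ) ^ (p / 2) * p * D' : ℤ) : ℚ)).rootNumber = -1 := by
  have hp : p.Prime := Fact.out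
  have hp2 : p ≠ 2 := by omega
  have hdZ0 : ((-1 : ℤ) ^ (p / 2) * p : ℤ) ≠ 0 :=
    mul_ne_zero (pow_ne_zero _ (by norm_num)) (by exact_mod_cast hp.ne_zero)
  have hd0 : (((((-1 : ℤ) ^ (p / 2) * p : ℤ)) : ℚ)) ≠ 0 := by exact_mod_cast hdZ0
  haveI hE' : (W.quadraticTwist (((-1 : ℤ) ^ (p / 2) * p : ℤ) : ℚ)).IsElliptic := W.isElliptic_quadraticTwist hd0
  have hA := rootNumber_mul_rootNumber_pStarTwist_of_six W hmod hp5 hN hM hpM hΔ hc₄ hj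
  obtain ⟨-, hgood, -⟩ := hasGoodReduction_pStarTwist_padic_of_six W hp5 hΔ hc₄ hj
  have hN' : (W.quadraticTwist (((-1 : ℤ) ^ (p / 2) * p : ℤ) : ℚ)).conductorNorm ℤ = M * p ^ 0 := by
    rw [conductorNorm_pStarTwist_mul_sq_eq_of_good W hp5 hN hpM hgood, pow_zero, mul_one]
  have hgcd' : Int.gcd D' (M * p ^ 0 : ℕ) = 1 := by
    rw [pow_zero, mul_one]
    have h1 := Int.isCoprime_iff_gcd_eq_one.mpr hgcd
    rw [hN] at h1
    push_cast at h1
    exact Int.isCoprime_iff_gcd_eq_one.mp h1.of_mul_right_left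
  rw [rootNumber_mul_rootNumber_ramifiedTwist_of_four_dvd_of_pStar W hmod hp2 hpM hN' hA h4 hm4 hsq hgcd' hneg hsplit, pow_zero, mul_one]
  linear_combination -(χ₄_natCast_mul_self hp2)

end EvenStarred

end Summit.BirchSwinnertonDyer.BirchSwinnertonDyer.Theorems.AdditiveKoly.RamifiedHabitat

end
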